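import Mathlib
import HarnessLib
import Summits.RiemannHypothesis.Statement
import Summits.RiemannHypothesis.RiemannHypothesis.Theorems.DeBrangesSuzukiDoorDoorModuloKernel
import Summits.RiemannHypothesis.RiemannHypothesis.Theorems.SuzukiWindowsDoorConverseRH
import Literature.NumberTheory.LFunctions.SuzukiSingleOperatorKernelProofs

/-!
# RiemannHypothesis / de Branges–Suzuki door — shift witnesses force RH; tail-rigidity of the window
criterion modulo one K-general spectral step (RAW zero-def form of cell rh-split, seat dbr/neg, gen 2)

For `θ > 10` and a non-zero real vector `c : Fin N → ℝ`, the SHIFT WITNESS is the window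
`W_c(u) = ∫_0^1 Σ_j c_j K_θ(u + y − j) dy = (𝖪_θ g_c)(u)`, `g_c = Σ_j c_j 1_{(−j,1−j)}` an integer-grid step
input (`N = 1, c = 1` is the door's own `W_θ = 𝖪_θ 1_{(0,1)}`).

* `rh_of_shiftWitness_memLp` (ζ-specific, PROVED): `W_c ∈ L²(ℝ)` for ONE `c ≠ 0` ⟹ `RiemannHypothesis`.
  Door with a multiplier: the shifted kernel `K_c = Σ c_j K_θ(· − j)` keeps K(ii)–(iii) and the `eˣ`
  bound, has Laplace transform `Θ_θ(z) · Σ_j c_j e^{izj}` (`laplace_shiftComb`), so Fubini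
  (`SuzukiDoor.laplace_window_eq`) gives `Θ_θ · F = G` on `Im z > 1` with `F = (Σ c_j e^{izj}) · unitLaplace`
  holomorphic on `ℂ₊`, `F(is) ≠ 0` for some `s > 0`, `G = ∫ W_c e^{izu} du` holomorphic on `ℂ₊`; the
  essential singularity of `Θ_θ` at an off-line zero is not cancellable (`SuzukiDoor.rh_of_symbolQuotientOn`).
* `rh_of_tailWindows_of_shiftWitnessStep`: for EVERY real `H`, «no eigenvalue `±1` of `𝖪_θ[t]` for
  `t > H`» ⟹ RH, MODULO the K-general spectral step «eventually no unit eigenvalue ⟹ some shift witness is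
  in `L²`» supplied as an explicit hypothesis (paper proof: singular values of the compressions are
  monotone and continuous in `t`; IVT; contraction on a cofinite-dimensional subspace; compactness of the
  unit sphere of the cell space — compact self-adjoint min–max / Weyl, not in Mathlib).  Corollaries:
  `tailWindows_iff_rh_of_shiftWitnessStep`, `and_tailWindows_imp_rh_of_shiftWitnessStep` (any FIN
  conjunct is decoration).

HONEST LABEL (lead ruling 19:52Z, card `cards/SPLIT-dbr-neg.md` §10): «TAIL(H) ⟺ RH modulo the explicit
K-general spectral hypothesis L1 (paper-proved, carried as a hypothesis here); ζ-half `rh_of_shiftWitness_memLp`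
unconditional». Replays: typer-2 g2 H1 farm replay of the seat's raw file (sha16 2162527d649ba070) 20:55Z —
rc 0 / 0 warnings / 0 sorry, `#print axioms tailWindows_iff_rh_of_shiftWitnessStep` =
[propext, Classical.choice, Quot.sound] (referee at wall). Filed by rh-split-typer-2 g2 as support of route
DeBrangesSuzukiDoor's residual `DoorWitness` (stmt-RiemannHypothesis-19728): the file widens the door's witness
class from `W_θ = 𝖪_θ 1_{(0,1)}` to every integer-grid step input. Booked under cell target T12.

RH-FREE implications about an RH-EQUIVALENT criterion; SPLITTING SEARCH bookkeeping; nothing in this file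
bears on the truth of RH.
-/

noncomputable section

set_option linter.dupNamespace false

namespace Summit.RiemannHypothesis.RiemannHypothesis.Theorems.SuzukiDoorShiftWitness

open Literature.NumberTheory.LFunctions MeasureTheory Complex Set Filter Topology
open Summit.RiemannHypothesis.RiemannHypothesis.Theorems

/-! ## §1 Generic lemmas: the shifted combination kernel `x ↦ Σ_j c_j K(x − j)` -/

section Generic

variable {K : ℝ → ℝ} {N : ℕ} (c : Fin N → ℝ)

/-- The shifted combination kernel `K_c(x) = Σ_{j<N} c_j K(x − j)` is continuous when `K` is. -/
theorem shiftComb_continuous (hKc : Continuous K) :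
    Continuous fun x : ℝ => ∑ j : Fin N, c j * K (x - ((j : ℕ) : ℝ)) :=
  continuous_finsetSum _ fun _ _ => continuous_const.mul (hKc.comp (continuous_id.sub continuous_const))

/-- `K_c` vanishes on `(−∞,0)` when `K` does (integer right-shifts keep the support in `[0,∞)`). -/
theorem shiftComb_eq_zero (hK0 : ∀ x : ℝ, x < 0 → K x = 0) {x : ℝ} (hx : x < 0) :
    ∑ j : Fin N, c j * K (x - ((j : ℕ) : ℝ)) = 0 := by
  refine Finset.sum_eq_zero fun j _ => ?_
  have hj : (0 : ℝ) ≤ ((j : ℕ) : ℝ) := Nat.cast_nonneg _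
  rw [hK0 _ (by linarith), mul_zero]

/-- `K_c` vanishes on `(−∞,0]` when `K` is continuous and vanishes on `(−∞,0)`. -/
theorem shiftComb_eq_zero_of_nonpos (hKc : Continuous K) (hK0 : ∀ x : ℝ, x < 0 → K x = 0) {x : ℝ}
    (hx : x ≤ 0) : ∑ j : Fin N, c j * K (x - ((j : ℕ) : ℝ)) = 0 := by
  refine Finset.sum_eq_zero fun j _ => ?_
  have hj : (0 : ℝ) ≤ ((j : ℕ) : ℝ) := Nat.cast_nonneg _
  rw [SuzukiDoor.eq_zero_of_nonpos_of_vanishing hKc hK0 (by linarith), mul_zero]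

/-- Exponential bound `|K_c(x)| ≤ (Σ_j |c_j|)·C·e^{a x}` on `[0,∞)` from `|K(x)| ≤ C e^{a x}` (`a ≥ 0`). -/
theorem abs_shiftComb_le (hK0 : ∀ x : ℝ, x < 0 → K x = 0) {C a : ℝ} (ha : 0 ≤ a)
    (hC : ∀ x : ℝ, 0 ≤ x → |K x| ≤ C * Real.exp (a * x)) (x : ℝ) (_hx : 0 ≤ x) :
    |∑ j : Fin N, c j * K (x - ((j : ℕ) : ℝ))| ≤ ((∑ j : Fin N, |c j|) * C) * Real.exp (a * x) := by
  have hC0 : 0 ≤ C := by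
    have := hC 0 le_rfl
    simp at this
    exact (abs_nonneg _).trans this
  have hterm : ∀ j : Fin N, |K (x - ((j : ℕ) : ℝ))| ≤ C * Real.exp (a * x) := by
    intro j
    rcases lt_or_ge (x - ((j : ℕ) : ℝ)) 0 with h | h
    · rw [hK0 _ h, abs_zero]; positivity
    · calc |K (x - ((j : ℕ) : ℝ))| ≤ C * Real.exp (a * (x - ((j : ℕ) : ℝ))) := hC _ h
        _ ≤ C * Real.exp (a * x) := by
            gcongr
            have hj : (0 : ℝ) ≤ ((j : ℕ) : ℝ) := Nat.cast_nonneg _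
            nlinarith
  calc |∑ j : Fin N, c j * K (x - ((j : ℕ) : ℝ))|
      ≤ ∑ j : Fin N, |c j * K (x - ((j : ℕ) : ℝ))| := Finset.abs_sum_le_sum_abs _ _
    _ = ∑ j : Fin N, |c j| * |K (x - ((j : ℕ) : ℝ))| := by simp_rw [abs_mul]
    _ ≤ ∑ j : Fin N, |c j| * (C * Real.exp (a * x)) := by
        gcongr with j _
        exact hterm j
    _ = ((∑ j : Fin N, |c j|) * C) * Real.exp (a * x) := by rw [← Finset.sum_mul]; ring

/-- The exponential sum `E_c(z) = Σ_j c_j e^{izj}` is entire. -/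
theorem differentiable_expSum :
    Differentiable ℂ fun z : ℂ => ∑ j : Fin N, (c j : ℂ) * Complex.exp (I * z * ((j : ℕ) : ℂ)) := by
  fun_prop

/-- Laplace transform of the shifted combination: `∫_0^∞ K_c(x) e^{izx} dx = Θ(z) · E_c(z)` (with
integrability), from the Laplace identity of `K` on `Im z > a` and the vanishing of `K` on `(−∞,0)`. -/
theorem laplace_shiftComb (hKc : Continuous K) (hK0 : ∀ x : ℝ, x < 0 → K x = 0) {a : ℝ} {Θ : ℂ → ℂ}
    (hLap : ∀ z : ℂ, a < z.im →
      IntegrableOn (fun x : ℝ => (K x : ℂ) * Complex.exp (I * z * (x : ℂ))) (Ioi 0) ∧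
        ∫ x in Ioi (0 : ℝ), (K x : ℂ) * Complex.exp (I * z * (x : ℂ)) = Θ z)
    {z : ℂ} (hz : a < z.im) :
    IntegrableOn (fun x : ℝ => ((∑ j : Fin N, c j * K (x - ((j : ℕ) : ℝ)) : ℝ) : ℂ) *
        Complex.exp (I * z * (x : ℂ))) (Ioi 0) ∧
      ∫ x in Ioi (0 : ℝ), ((∑ j : Fin N, c j * K (x - ((j : ℕ) : ℝ)) : ℝ) : ℂ) *
          Complex.exp (I * z * (x : ℂ)) =
        Θ z * ∑ j : Fin N, (c j : ℂ) * Complex.exp (I * z * ((j : ℕ) : ℂ)) := by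
  obtain ⟨hIK, hK⟩ := hLap z hz
  set g : ℝ → ℂ := fun x => (K x : ℂ) * Complex.exp (I * z * (x : ℂ)) with hg_def
  have hg0 : ∀ x : ℝ, x ∉ Ioi (0 : ℝ) → g x = 0 := by
    intro x hx
    have : K x = 0 := SuzukiDoor.eq_zero_of_nonpos_of_vanishing hKc hK0 (not_lt.mp hx)
    simp [hg_def, this]
  have hgi : Integrable g := hIK.integrable_of_forall_notMem_eq_zero hg0
  have hgint : ∫ x : ℝ, g x = Θ z := by
    rw [← setIntegral_eq_integral_of_forall_compl_eq_zero hg0]; exact hK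
  have hterm_eq : ∀ (j : Fin N) (x : ℝ),
      ((c j * K (x - ((j : ℕ) : ℝ)) : ℝ) : ℂ) * Complex.exp (I * z * (x : ℂ)) =
        ((c j : ℂ) * Complex.exp (I * z * ((j : ℕ) : ℂ))) * g (x - ((j : ℕ) : ℝ)) := by
    intro j x
    simp only [hg_def]
    have he : Complex.exp (I * z * (x : ℂ)) =
        Complex.exp (I * z * ((j : ℕ) : ℂ)) * Complex.exp (I * z * (((x - ((j : ℕ) : ℝ) : ℝ)) : ℂ)) := by
      rw [← Complex.exp_add]; congr 1; push_cast; ring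
    rw [he]; push_cast; ring
  have hterm_int : ∀ j : Fin N, Integrable (fun x : ℝ =>
      ((c j * K (x - ((j : ℕ) : ℝ)) : ℝ) : ℂ) * Complex.exp (I * z * (x : ℂ))) := by
    intro j
    simp_rw [hterm_eq j]
    exact (hgi.comp_sub_right ((j : ℕ) : ℝ)).const_mul _
  have hterm_val : ∀ j : Fin N, ∫ x : ℝ,
      ((c j * K (x - ((j : ℕ) : ℝ)) : ℝ) : ℂ) * Complex.exp (I * z * (x : ℂ)) =
        ((c j : ℂ) * Complex.exp (I * z * ((j : ℕ) : ℂ))) * Θ z := by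
    intro j
    simp_rw [hterm_eq j]
    rw [integral_const_mul, integral_sub_right_eq_self g ((j : ℕ) : ℝ), hgint]
  have hsum_eq : ∀ x : ℝ, ((∑ j : Fin N, c j * K (x - ((j : ℕ) : ℝ)) : ℝ) : ℂ) *
      Complex.exp (I * z * (x : ℂ)) =
      ∑ j : Fin N, ((c j * K (x - ((j : ℕ) : ℝ)) : ℝ) : ℂ) * Complex.exp (I * z * (x : ℂ)) := by
    intro x
    push_cast
    rw [Finset.sum_mul]
  have hint : Integrable (fun x : ℝ => ((∑ j : Fin N, c j * K (x - ((j : ℕ) : ℝ)) : ℝ) : ℂ) *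
      Complex.exp (I * z * (x : ℂ))) := by
    simp_rw [hsum_eq]
    exact integrable_finsetSum _ fun j _ => hterm_int j
  have hvan : ∀ x : ℝ, x ∉ Ioi (0 : ℝ) →
      ((∑ j : Fin N, c j * K (x - ((j : ℕ) : ℝ)) : ℝ) : ℂ) * Complex.exp (I * z * (x : ℂ)) = 0 := by
    intro x hx
    rw [shiftComb_eq_zero_of_nonpos c hKc hK0 (not_lt.mp hx)]
    simp
  refine ⟨hint.integrableOn, ?_⟩
  rw [setIntegral_eq_integral_of_forall_compl_eq_zero hvan]
  simp_rw [hsum_eq]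
  rw [integral_finsetSum _ fun j _ => hterm_int j]
  simp_rw [hterm_val]
  rw [← Finset.sum_mul, mul_comm]

/-- A non-zero real exponential sum does not vanish identically on the positive imaginary axis:
`∃ s > 0, Σ_j c_j e^{−sj} ≠ 0` (finitely many roots of `Σ c_j w^j` in `(0,1)`). -/
theorem exists_expSum_ne_zero (hc : c ≠ 0) :
    ∃ s : ℝ, 0 < s ∧ ∑ j : Fin N, (c j : ℂ) * Complex.exp (I * (I * (s : ℂ)) * ((j : ℕ) : ℂ)) ≠ 0 := by
  classical
  set p : Polynomial ℝ := ∑ j : Fin N, Polynomial.monomial (j : ℕ) (c j) with hp_def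
  have hp : p ≠ 0 := by
    intro h0
    apply hc
    funext k
    have hk : p.coeff (k : ℕ) = c k := by
      rw [hp_def, Polynomial.finsetSum_coeff]
      rw [Finset.sum_eq_single k]
      · simp
      · intro j _ hjk
        rw [Polynomial.coeff_monomial, if_neg]
        exact fun h => hjk (Fin.ext h)
      · intro h; exact absurd (Finset.mem_univ k) h
    rw [h0, Polynomial.coeff_zero] at hk
    simpa using hk.symm
  have hfin : {w : ℝ | p.IsRoot w}.Finite := Polynomial.finite_setOf_isRoot hp
  obtain ⟨w, hwI, hwr⟩ := ((Set.Ioo_infinite (zero_lt_one' ℝ)).sdiff hfin).nonempty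
  have hw0 : 0 < w := hwI.1
  have hw1 : w < 1 := hwI.2
  have heval : p.eval w = ∑ j : Fin N, c j * w ^ (j : ℕ) := by
    rw [hp_def, Polynomial.eval_finsetSum]
    simp [Polynomial.eval_monomial]
  have hne : ∑ j : Fin N, c j * w ^ (j : ℕ) ≠ 0 := by
    rw [← heval]; exact hwr
  refine ⟨-Real.log w, by
    have := Real.log_neg hw0 hw1; linarith, ?_⟩
  have hexp : ∀ j : Fin N, Complex.exp (I * (I * ((-Real.log w : ℝ) : ℂ)) * ((j : ℕ) : ℂ)) =
      ((w ^ (j : ℕ) : ℝ) : ℂ) := by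
    intro j
    have h1 : I * (I * ((-Real.log w : ℝ) : ℂ)) * ((j : ℕ) : ℂ) = ((j : ℕ) : ℂ) * ((Real.log w : ℝ) : ℂ) := by
      rw [Complex.ofReal_neg]
      linear_combination (-(((Real.log w : ℝ) : ℂ)) * ((j : ℕ) : ℂ)) * I_mul_I
    rw [h1, Complex.exp_nat_mul, ← Complex.ofReal_exp, Real.exp_log hw0]
    push_cast; rfl
  simp_rw [hexp]
  exact_mod_cast hne

end Generic

/-- `unitLaplace (is) = (e^s − 1)/s ≠ 0` for `s > 0`. -/
theorem unitLaplace_I_mul_ne_zero {s : ℝ} (hs : 0 < s) : SuzukiDoor.unitLaplace (I * (s : ℂ)) ≠ 0 := by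
  have hs0 : (s : ℂ) ≠ 0 := by exact_mod_cast hs.ne'
  rw [SuzukiDoor.unitLaplace_eq _ (mul_ne_zero I_ne_zero hs0)]
  have h1 : -(I * (I * (s : ℂ))) = (s : ℂ) := by
    rw [← mul_assoc, I_mul_I]; ring
  rw [h1]
  refine div_ne_zero ?_ hs0
  rw [sub_ne_zero, ← Complex.ofReal_exp]
  have h3 : (1 : ℝ) < Real.exp s := by
    have := Real.add_one_lt_exp hs.ne'; linarith
  exact_mod_cast h3.ne'

/-! ## §2 The ζ-specific half: one shift witness in `L²` forces RH -/

/-- **Shift witnesses force RH.** For `θ > 10` and `c ≠ 0`: if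
`u ↦ ∫_0^1 Σ_j c_j K_θ(u + y − j) dy` (`= 𝖪_θ g_c`, `g_c = Σ_j c_j 1_{(−j,1−j)}`) is in `L²(ℝ)`, then RH. -/
theorem rh_of_shiftWitness_memLp {θ : ℝ} (hθ : 10 < θ) {N : ℕ} {c : Fin N → ℝ} (hc : c ≠ 0)
    (hW : MemLp (fun u : ℝ => ∫ y in Ioo (0 : ℝ) 1,
      ∑ j : Fin N, c j * limKernel θ (u + y - ((j : ℕ) : ℝ))) 2 volume) :
    _root_.RiemannHypothesis := by
  set K : ℝ → ℝ := limKernel θ with hK_def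
  have hKc : Continuous K := Suzuki2020_thm12_continuous (by linarith)
  have hK0 : ∀ x : ℝ, x < 0 → K x = 0 := fun x hx => Suzuki2020_thm12_Kiii (by linarith) hx
  obtain ⟨C, hC⟩ : ∃ C : ℝ, ∀ x : ℝ, 0 ≤ x → |K x| ≤ C * Real.exp (1 * x) :=
    ⟨_, fun x _ => SuzukiDoor.abs_limKernel_le_exp θ x⟩
  have hLap : ∀ z : ℂ, 1 < z.im →
      IntegrableOn (fun x : ℝ => (K x : ℂ) * Complex.exp (I * z * (x : ℂ))) (Ioi 0) ∧
        ∫ x in Ioi (0 : ℝ), (K x : ℂ) * Complex.exp (I * z * (x : ℂ)) = limTheta θ z :=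
    fun z hz => Suzuki2020_thm12_laplace (by linarith) (by linarith)
  -- the shifted combination kernel `Kc`
  set Kc : ℝ → ℝ := fun x => ∑ j : Fin N, c j * K (x - ((j : ℕ) : ℝ)) with hKc_def
  have hKcc : Continuous Kc := shiftComb_continuous c hKc
  have hKc0 : ∀ x : ℝ, x < 0 → Kc x = 0 := fun x hx => shiftComb_eq_zero c hK0 hx
  have hCc : ∀ x : ℝ, 0 ≤ x → |Kc x| ≤ ((∑ j : Fin N, |c j|) * C) * Real.exp (1 * x) :=
    abs_shiftComb_le c hK0 zero_le_one hC
  set E : ℂ → ℂ := fun z => ∑ j : Fin N, (c j : ℂ) * Complex.exp (I * z * ((j : ℕ) : ℂ)) with hE_def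
  have hLapc : ∀ z : ℂ, 1 < z.im →
      IntegrableOn (fun x : ℝ => (Kc x : ℂ) * Complex.exp (I * z * (x : ℂ))) (Ioi 0) ∧
        ∫ x in Ioi (0 : ℝ), (Kc x : ℂ) * Complex.exp (I * z * (x : ℂ)) = limTheta θ z * E z :=
    fun z hz => laplace_shiftComb c hKc hK0 hLap hz
  -- the witness window is the unit-window average of `Kc`; it vanishes on (−∞,−1]
  have hWin : (fun u : ℝ => ∫ y in Ioo (0 : ℝ) 1, ∑ j : Fin N, c j * limKernel θ (u + y - ((j : ℕ) : ℝ))) =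
      fun u : ℝ => ∫ y in Ioo (0 : ℝ) 1, Kc (u + y) := rfl
  rw [hWin] at hW
  have hW0 : ∀ u : ℝ, u ≤ -1 → (∫ y in Ioo (0 : ℝ) 1, Kc (u + y)) = 0 := fun u hu =>
    SuzukiDoor.window_eq_zero_of_le hKc0 hu
  -- G and F
  set G : ℂ → ℂ := fun z => ∫ u : ℝ, ((∫ y in Ioo (0 : ℝ) 1, Kc (u + y) : ℝ) : ℂ) *
    Complex.exp (I * z * (u : ℂ)) with hG_def
  set F : ℂ → ℂ := fun z => E z * SuzukiDoor.unitLaplace z with hF_def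
  have hG : DifferentiableOn ℂ G {z : ℂ | 0 < z.im} :=
    SuzukiDoor.differentiableOn_laplace_of_memLp hW hW0
  have hF : DifferentiableOn ℂ F {z : ℂ | 0 < z.im} :=
    (differentiable_expSum c).differentiableOn.mul SuzukiDoor.differentiableOn_unitLaplace
  have hF0 : ∃ z : ℂ, 0 < z.im ∧ F z ≠ 0 := by
    obtain ⟨s, hs, hE⟩ := exists_expSum_ne_zero c hc
    refine ⟨I * (s : ℂ), by simpa using hs, ?_⟩
    exact mul_ne_zero hE (unitLaplace_I_mul_ne_zero hs)
  have hGF : ∀ z : ℂ, 1 < z.im → SuzukiDoor.limTheta θ z * F z = G z := by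
    intro z hz
    have h1 := SuzukiDoor.laplace_window_eq hKcc hKc0 zero_le_one hCc hz
    rw [(hLapc z hz).2] at h1
    rw [SuzukiWindowsDoorConverse.limTheta_eq_lit, hF_def, hG_def]
    simp only
    rw [← mul_assoc, ← h1]
  exact SuzukiDoor.rh_of_symbolQuotientOn (θ := θ) (a := 1) (by linarith) (by norm_num) hG hF hF0 hGF

/-! ## §3 Tail-rigidity of the window criterion modulo the K-general spectral step -/

/-- **Tail-clean windows force RH, modulo the spectral step.** For `θ > 10` and EVERY real `H`: if the
K-general step «no eigenvalue `±1` of `𝖪_θ[t]` for `t > H` ⟹ some shift witness is in `L²`» is granted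
(hypothesis `hstep`; compact self-adjoint min–max/Weyl + compactness, paper-proved, not in Mathlib),
then «no eigenvalue `±1` for `t > H`» implies RH. -/
theorem rh_of_tailWindows_of_shiftWitnessStep {θ : ℝ} (hθ : 10 < θ) (H : ℝ)
    (hstep : (∀ t : ℝ, H < t → NoUnitEigenvalue (limKernel θ) t) →
      ∃ (N : ℕ) (c : Fin N → ℝ), c ≠ 0 ∧ MemLp (fun u : ℝ => ∫ y in Ioo (0 : ℝ) 1,
        ∑ j : Fin N, c j * limKernel θ (u + y - ((j : ℕ) : ℝ))) 2 volume)
    (hT : ∀ t : ℝ, H < t → NoUnitEigenvalue (limKernel θ) t) : _root_.RiemannHypothesis := by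
  obtain ⟨N, c, hc, hW⟩ := hstep hT
  exact rh_of_shiftWitness_memLp hθ hc hW

/-- Converse (tree): RH ⟹ every window is clean, in particular every tail. -/
theorem tailWindows_of_rh (hRH : _root_.RiemannHypothesis) {θ : ℝ} (hθ : 10 < θ) (H : ℝ) :
    ∀ t : ℝ, H < t → NoUnitEigenvalue (limKernel θ) t :=
  fun t _ => SuzukiWindowsDoorConverse.noUnitEigenvalue_limKernel_of_riemannHypothesis hRH hθ t

/-- **TAIL ⟺ RH for every `H`, modulo the spectral step.** -/
theorem tailWindows_iff_rh_of_shiftWitnessStep {θ : ℝ} (hθ : 10 < θ) (H : ℝ)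
    (hstep : (∀ t : ℝ, H < t → NoUnitEigenvalue (limKernel θ) t) →
      ∃ (N : ℕ) (c : Fin N → ℝ), c ≠ 0 ∧ MemLp (fun u : ℝ => ∫ y in Ioo (0 : ℝ) 1,
        ∑ j : Fin N, c j * limKernel θ (u + y - ((j : ℕ) : ℝ))) 2 volume) :
    (∀ t : ℝ, H < t → NoUnitEigenvalue (limKernel θ) t) ↔ _root_.RiemannHypothesis :=
  ⟨rh_of_tailWindows_of_shiftWitnessStep hθ H hstep, fun h => tailWindows_of_rh h hθ H⟩

/-- **Any FIN conjunct is decoration, modulo the spectral step**: `A ∧ TAIL(H) → RH` for every `A`. -/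
theorem and_tailWindows_imp_rh_of_shiftWitnessStep {θ : ℝ} (hθ : 10 < θ) (H : ℝ) (A : Prop)
    (hstep : (∀ t : ℝ, H < t → NoUnitEigenvalue (limKernel θ) t) →
      ∃ (N : ℕ) (c : Fin N → ℝ), c ≠ 0 ∧ MemLp (fun u : ℝ => ∫ y in Ioo (0 : ℝ) 1,
        ∑ j : Fin N, c j * limKernel θ (u + y - ((j : ℕ) : ℝ))) 2 volume) :
    A ∧ (∀ t : ℝ, H < t → NoUnitEigenvalue (limKernel θ) t) → _root_.RiemannHypothesis :=
  fun h => rh_of_tailWindows_of_shiftWitnessStep hθ H hstep h.2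

/-- **The K-general spectral step implies tail-rigidity for all `θ > 10` and all `H` at once.** -/
theorem tailWindows_iff_rh_of_generalStep
    (hL1 : ∀ K : ℝ → ℝ, Continuous K → ∀ H : ℝ, (∀ t : ℝ, H < t → NoUnitEigenvalue K t) →
      ∃ (N : ℕ) (c : Fin N → ℝ), c ≠ 0 ∧ MemLp (fun u : ℝ => ∫ y in Ioo (0 : ℝ) 1,
        ∑ j : Fin N, c j * K (u + y - ((j : ℕ) : ℝ))) 2 volume)
    {θ : ℝ} (hθ : 10 < θ) (H : ℝ) :
    (∀ t : ℝ, H < t → NoUnitEigenvalue (limKernel θ) t) ↔ _root_.RiemannHypothesis :=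
  tailWindows_iff_rh_of_shiftWitnessStep hθ H
    (hL1 (limKernel θ) (Suzuki2020_thm12_continuous (by linarith)) H)

end Summit.RiemannHypothesis.RiemannHypothesis.Theorems.SuzukiDoorShiftWitness

end
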